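import Summits.AtomisticToContinuum.Crystallization.Theses.NashClassCertificates
import Summits.AtomisticToContinuum.Crystallization.Theorems.NearFieldConvexity.Negative.LoadBearing

/-!
# Negative knowledge for crux `NashNearField` (stmt-AtomisticToContinuum-16827) — the Nash
# restriction of the near-field inequality: what is load-bearing, what is vacuous
# (standing disprover, gen 1)

`NashClassCertificates.NashNearField` (route `NashClassCertificates`, rank 3) is the crux
`PhononSlackCertificates.NearFieldConvexity` (stmt-13958) SPECIALISED to separation `δ = 1/3` and
RESTRICTED to Nash configurations (no particle lowers its site energy by relocating to a free
point): for every `η > 0` there are `c > 0`, `C` with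
`c · #{i ∈ Ω : B(xᵢ,2) not η-layered} − C · #{i ∈ Ω : ∃ j ∉ Ω, |xⱼ − xᵢ| ≤ 4} ≤ Σ_{i ∈ Ω} (e_i − e*)`
for every `1/3`-separated Nash `x` and every set `Ω` of `1/20`-good particles
(read-back `nashNearField_iff`, `Iff.rfl` against the vocabulary of
`NearFieldConvexity/Negative/LoadBearing.lean` plus `IsNash`).

Proved here (all [folklore]):

* `nashNearFieldWithoutNash_of_nearFieldConvexity`, `not_nashNearFieldWithoutNash_of_not`,
  `not_nearFieldConvexity_of_not_nashNearField` — dropping the Nash hypothesis gives exactly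
  `NearFieldConvexity` at `δ = 1/3`; so a proof of 13958 proves this crux and a refutation of this
  crux refutes 13958 (the Nash hypothesis can only HELP; whether it is needed is open).
* `nashNearField_false_without_nash_and_separation` — dropping Nash AND separation is FALSE
  (the collinear comb of `NearFieldConvexity/Negative/Comb.lean`: one good particle next to
  arbitrarily dense matter, `Ω = {centre}`).  The comb is not Nash (its far particles are unbound),
  so on the Nash class the separation hypothesis alone is not shown load-bearing here.
* `isLayeredNear_of_two_le`, `nlCount_eq_zero_of_two_le`, `isLayeredNear_mono`, `nlCount_anti` —
  the matching predicate is monotone in `η` and VACUOUS for `η ≥ 2` (every particle of every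
  configuration is `η`-layered: take `t = −xᵢ` and the site `0` of any stacking).
* `nashBoundaryFloor_of_nashNearField`, `nashNearField_iff_floor_and_small` — hence the crux is
  EXACTLY its `c = 0` shadow `NashBoundaryFloor` (`Σ_{Ω}(e_i − e*) ≥ −C·#∂₄Ω` on the Nash class)
  together with the inequality for `η < 2`; and (`nashNearField_iff_small`) for any `η₀ > 0` only
  the tolerances `η < η₀` matter (constants found at `η` serve every `η' ≥ η`).

Not provable here (see the workfile `Cruxes/NashNearField/Disproof.lean`): any witness against the
crux itself must be a `1/3`-separated NASH configuration with good particles — an equilibrium,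
globally stable under single-particle relocation; no such configuration with `N ≥ 19` is explicit
(ground states are Nash but structurally unknown), which is why the natural strengthening
"`c` uniform in `η`" (false by linear elasticity: the excess of a sheared good region is quadratic in
the strain while the mismatch is linear) has no Lean witness on the Nash class.
Supports item stmt-AtomisticToContinuum-16827.
-/

noncomputable section

open scoped BigOperators
open Literature.MathematicalPhysics.StatisticalMechanics Literature.Geometry.DiscreteGeometry

namespace Summit.AtomisticToContinuum.Crystallization.Theorems.NashNearField.Negative.LoadBearing

open Summit.AtomisticToContinuum.Crystallization.Theses.NashClassCertificates (NashNearField)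
open Summit.AtomisticToContinuum.Crystallization.Theses.PhononSlackCertificates (NearFieldConvexity)
open Summit.AtomisticToContinuum.Crystallization.Theorems.ChargedEnergyGapNegative (eStar)
open Summit.AtomisticToContinuum.Crystallization.Theorems.NearFieldConvexity.Negative.Comb
open Summit.AtomisticToContinuum.Crystallization.Theorems.NearFieldConvexity.Negative.LoadBearing

local notation "E3" => EuclideanSpace ℝ (Fin 3)

/-! ## Read-back vocabulary -/

/-- The crux's NASH hypothesis (verbatim): no particle lowers its site energy by relocating to a
point distinct from the other particles — `x` is a pure Nash equilibrium of the site-selection game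
(Monderer–Shapley potential game whose potential is the energy). [cite: MondererShapley1996] -/
def IsNash {N : ℕ} (x : Fin N → E3) : Prop :=
  ∀ (i : Fin N) (y : E3), (∀ j : Fin N, j ≠ i → y ≠ x j) →
    siteEnergy lennardJones x i ≤ ∑ j ∈ Finset.univ.erase i, lennardJones (dist y (x j))

/-- The crux's inequality at tolerance `η` with constants `c, C`, for one configuration and one
set `Ω` (verbatim, in the vocabulary of `NearFieldConvexity/Negative/LoadBearing`). -/
def NearIneq (η c C : ℝ) {N : ℕ} (x : Fin N → E3) (Ω : Finset (Fin N)) : Prop :=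
  c * (nlCount η x Ω : ℝ) - C * (bdCount 4 x Ω : ℝ) ≤ excessSum x Ω

/-- READ-BACK: the crux, definitionally. [folklore] -/
theorem nashNearField_iff :
    NashNearField ↔ ∀ η : ℝ, 0 < η → ∃ c : ℝ, 0 < c ∧ ∃ C : ℝ, ∀ (N : ℕ) (x : Fin N → E3),
      Separated (1 / 3) x → IsNash x → ∀ Ω : Finset (Fin N),
        (∀ i ∈ Ω, IsTwoShellGood (1 / 20) (47 / 50) 1 x i) → NearIneq η c C x Ω :=
  Iff.rfl

/-! ## The Nash hypothesis dropped: the all-configuration crux 13958 at `δ = 1/3` -/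

/-- The crux WITHOUT THE NASH HYPOTHESIS: `NearFieldConvexity` (stmt-13958) at `δ = 1/3`. -/
def NashNearFieldWithoutNash : Prop :=
  ∀ η : ℝ, 0 < η → ∃ c : ℝ, 0 < c ∧ ∃ C : ℝ, ∀ (N : ℕ) (x : Fin N → E3),
    Separated (1 / 3) x → ∀ Ω : Finset (Fin N),
      (∀ i ∈ Ω, IsTwoShellGood (1 / 20) (47 / 50) 1 x i) → NearIneq η c C x Ω

/-- `NearFieldConvexity` (all `δ`) gives the Nash-free version at `δ = 1/3`. [folklore] -/
theorem nashNearFieldWithoutNash_of_nearFieldConvexity (h : NearFieldConvexity) :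
    NashNearFieldWithoutNash := fun η hη =>
  (nearFieldConvexity_iff_radius.1 h) (1 / 3) (by norm_num) η hη

/-- Restricting to the Nash class can only help: a refutation of the crux refutes its Nash-free
version (contrapositive of the trivial implication). [folklore] -/
theorem not_nashNearFieldWithoutNash_of_not (h : ¬ NashNearField) : ¬ NashNearFieldWithoutNash := by
  intro h'
  apply h
  rw [nashNearField_iff]
  intro η hη
  obtain ⟨c, hc, C, hC⟩ := h' η hη
  exact ⟨c, hc, C, fun N x hsep _ Ω hΩ => hC N x hsep Ω hΩ⟩

/-- Hence a refutation of `NashNearField` would refute `NearFieldConvexity` (stmt-13958) as well —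
shared negative knowledge between the two routes. [folklore] -/
theorem not_nearFieldConvexity_of_not_nashNearField (h : ¬ NashNearField) : ¬ NearFieldConvexity :=
  fun h' => not_nashNearFieldWithoutNash_of_not h (nashNearFieldWithoutNash_of_nearFieldConvexity h')

/-! ## Nash and separation both dropped: false -/

/-- The crux with BOTH the Nash and the separation hypotheses dropped. -/
def NashNearFieldWithoutNashSep : Prop :=
  ∀ η : ℝ, 0 < η → ∃ c : ℝ, 0 < c ∧ ∃ C : ℝ, ∀ (N : ℕ) (x : Fin N → E3),
    ∀ Ω : Finset (Fin N), (∀ i ∈ Ω, IsTwoShellGood (1 / 20) (47 / 50) 1 x i) → NearIneq η c C x Ω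

/-- **Without Nash and without separation the statement is FALSE**: the collinear comb (a perfect
fcc two-shell cluster plus `M` far particles on `[2, 5/2)·e₀`, `Ω = {centre}`) has right-hand side
`≤ −M/4000 + 2³²/12` and left-hand side `≥ −|C|`.  (The comb is not Nash — its far particles are
unbound — so this does not show separation alone load-bearing on the Nash class.) [folklore] -/
theorem nashNearField_false_without_nash_and_separation : ¬ NashNearFieldWithoutNashSep := by
  intro h
  obtain ⟨c, hc, C, h⟩ := h 1 one_pos
  obtain ⟨M, -, hbig⟩ := exists_big C
  exact comb_violates hc hbig (h _ (comb M) {centre M} (good_of_mem_centre M))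

/-! ## The matching predicate: monotone in `η`, vacuous for `η ≥ 2` -/

/-- Matching is monotone in the tolerance. [folklore] -/
theorem isLayeredNear_mono {N : ℕ} {η η' : ℝ} {x : Fin N → E3} {i : Fin N}
    (h : IsLayeredNear η x i) (hle : η ≤ η') : IsLayeredNear η' x i := by
  obtain ⟨A, t, a, s, z, ha₁, ha₂, hs, hz, h₁, h₂⟩ := h
  refine ⟨A, t, a, s, z, ha₁, ha₂, hs, hz, fun j hj => ?_, fun p hp hd => ?_⟩
  · obtain ⟨p, hp, hd⟩ := h₁ j hj
    exact ⟨p, hp, hd.trans hle⟩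
  · obtain ⟨j, hj⟩ := h₂ p hp hd
    exact ⟨j, hj.trans hle⟩

/-- Hence the unmatched count is antitone in the tolerance. [folklore] -/
theorem nlCount_anti {N : ℕ} {η η' : ℝ} (hle : η ≤ η') (x : Fin N → E3) (Ω : Finset (Fin N)) :
    nlCount η' x Ω ≤ nlCount η x Ω := by
  unfold nlCount
  exact Nat.card_le_card_of_injective
    (fun i => ⟨i.1, i.2.1, fun h => i.2.2 (isLayeredNear_mono h hle)⟩) fun a b hab => Subtype.ext (by
      simpa using congrArg Subtype.val hab)

/-- **For `η ≥ 2` every particle of every configuration is `η`-layered**: translate `xᵢ` to the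
site `0` of the fcc stacking at scale `1` (Hägg word `+1`, interlayer spacing `4/5`); every particle
of the `2`-ball and every site of the `2`-ball are then within `2 ≤ η` of `0`. [folklore] -/
theorem isLayeredNear_of_two_le {N : ℕ} {η : ℝ} (hη : 2 ≤ η) (x : Fin N → E3) (i : Fin N) :
    IsLayeredNear η x i := by
  refine ⟨LinearIsometry.id, -x i, 1, fun _ => 1, fun m => 4 / 5 * (m : ℝ), by norm_num, le_rfl,
    fun _ => Or.inl rfl, fun m => ?_, ?_⟩
  · push_cast
    constructor <;> linarith
  · intro S
    have h0 : (0 : E3) ∈ S := ⟨0, 0, 0, by simp⟩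
    have hxi : x i + -x i = 0 := add_neg_cancel (x i)
    refine ⟨fun j hj => ⟨0, h0, ?_⟩, fun p _ hd => ⟨i, ?_⟩⟩
    · rw [← sub_eq_add_neg, dist_zero_right, ← dist_eq_norm]
      exact hj.trans hη
    · rw [hxi] at hd ⊢
      rw [dist_comm]
      exact hd.trans hη

/-- Hence for `η ≥ 2` the unmatched count vanishes identically. [folklore] -/
theorem nlCount_eq_zero_of_two_le {N : ℕ} {η : ℝ} (hη : 2 ≤ η) (x : Fin N → E3)
    (Ω : Finset (Fin N)) : nlCount η x Ω = 0 := by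
  unfold nlCount
  rw [Nat.card_eq_zero]
  exact Or.inl ⟨fun i => i.2.2 (isLayeredNear_of_two_le hη x i.1)⟩

/-! ## The `c = 0` shadow on the Nash class, and the shape of the `η`-quantifier -/

/-- The BOUNDARY FLOOR ON THE NASH CLASS: `Σ_{i∈Ω}(e_i − e*) ≥ −C·#∂₄Ω` for every `1/3`-separated
Nash `x` and every good `Ω` — the `c = 0` shadow of the crux (its whole content at `η ≥ 2`). -/
def NashBoundaryFloor : Prop :=
  ∃ C : ℝ, ∀ (N : ℕ) (x : Fin N → E3), Separated (1 / 3) x → IsNash x →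
    ∀ Ω : Finset (Fin N), (∀ i ∈ Ω, IsTwoShellGood (1 / 20) (47 / 50) 1 x i) →
      -(C * (bdCount 4 x Ω : ℝ)) ≤ excessSum x Ω

/-- **The crux implies the boundary floor on the Nash class** (drop the non-negative `c`-term at
`η = 1`). [folklore] -/
theorem nashBoundaryFloor_of_nashNearField (h : NashNearField) : NashBoundaryFloor := by
  obtain ⟨c, hc, C, h⟩ := (nashNearField_iff.1 h) 1 one_pos
  refine ⟨C, fun N x hsep hN Ω hΩ => ?_⟩
  have key : NearIneq 1 c C x Ω := h N x hsep hN Ω hΩ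
  unfold NearIneq at key
  have h1 : 0 ≤ c * (nlCount 1 x Ω : ℝ) := mul_nonneg hc.le (Nat.cast_nonneg _)
  linarith

/-- **The crux is exactly the boundary floor plus its inequality for `η < 2`**: at `η ≥ 2` the
unmatched count is zero, so the inequality there IS the floor. [folklore] -/
theorem nashNearField_iff_floor_and_small :
    NashNearField ↔ NashBoundaryFloor ∧ ∀ η : ℝ, 0 < η → η < 2 → ∃ c : ℝ, 0 < c ∧ ∃ C : ℝ,
      ∀ (N : ℕ) (x : Fin N → E3), Separated (1 / 3) x → IsNash x → ∀ Ω : Finset (Fin N),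
        (∀ i ∈ Ω, IsTwoShellGood (1 / 20) (47 / 50) 1 x i) → NearIneq η c C x Ω := by
  constructor
  · intro h
    exact ⟨nashBoundaryFloor_of_nashNearField h, fun η hη _ => (nashNearField_iff.1 h) η hη⟩
  · rintro ⟨⟨C, hC⟩, hsmall⟩
    rw [nashNearField_iff]
    intro η hη
    rcases lt_or_ge η 2 with hlt | hge
    · exact hsmall η hη hlt
    · refine ⟨1, one_pos, C, fun N x hsep hN Ω hΩ => ?_⟩
      unfold NearIneq
      rw [nlCount_eq_zero_of_two_le hge, Nat.cast_zero, mul_zero, zero_sub]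
      exact hC N x hsep hN Ω hΩ

/-- **Only small tolerances matter**: for every `η₀ > 0` the crux is equivalent to its restriction
to `η < η₀` (constants found at `η` serve every `η' ≥ η`, the unmatched count being antitone).
[folklore] -/
theorem nashNearField_iff_small {η₀ : ℝ} (hη₀ : 0 < η₀) :
    NashNearField ↔ ∀ η : ℝ, 0 < η → η < η₀ → ∃ c : ℝ, 0 < c ∧ ∃ C : ℝ,
      ∀ (N : ℕ) (x : Fin N → E3), Separated (1 / 3) x → IsNash x → ∀ Ω : Finset (Fin N),
        (∀ i ∈ Ω, IsTwoShellGood (1 / 20) (47 / 50) 1 x i) → NearIneq η c C x Ω := by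
  rw [nashNearField_iff]
  constructor
  · exact fun h η hη _ => h η hη
  · intro h η hη
    rcases lt_or_ge η η₀ with hlt | hge
    · exact h η hη hlt
    · obtain ⟨c, hc, C, hC⟩ := h (η₀ / 2) (by positivity) (by linarith)
      refine ⟨c, hc, C, fun N x hsep hN Ω hΩ => ?_⟩
      have key := hC N x hsep hN Ω hΩ
      unfold NearIneq at key ⊢
      have hmono : (nlCount η x Ω : ℝ) ≤ (nlCount (η₀ / 2) x Ω : ℝ) := by
        exact_mod_cast nlCount_anti (by linarith) x Ω
      nlinarith [mul_le_mul_of_nonneg_left hmono hc.le]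

end Summit.AtomisticToContinuum.Crystallization.Theorems.NashNearField.Negative.LoadBearing
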